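import Summits.QuantumFields.YangMills.Theorems.UnitScaleTiltProp7SectET3DeltaPiT3
import Literature.MathematicalPhysics.QuantumFieldTheory.Balaban1983to89.B11Eq103H1ComplexReality
import HarnessLib

/-!
# Route `UnitScaleTilt`, crux K1 child «MinimiserStabilityRegPr» (stmt-QuantumFields-19200), skeleton v10, stub `stub_existenceMinimalOrbit` (EX),
# route (α) — **REALITY OF THE CURVED PROPAGATOR LETTERS IS INHERITED FROM THEIR DATA**: print's `G = Δ_a⁻¹`, `(QGQ*)⁻¹`, `H = GQ*(QGQ*)⁻¹` (3.122)–(3.126),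
# `G′ = (Δ′_a)⁻¹` (3.25), `R` (3.21), the gauge correction `1 − DG′RD*` and `Δ_π` (3.119), hence `H(U₀)` of the EX binder `h46tw` (brick L0b-2's `Hpi`∕`H46`),
# COMMUTE WITH EVERY (ANTI-)UNITARY ADDITIVE INVOLUTION TRIPLE `(σ_E, σ_S, σ_F)` THAT THE THREE DATA LETTERS `D_{U₀}`, `Q(U₀)`, `Δ^η_{U₀}` COMMUTE WITH

Cell `ym3-torus`, width seat `ym-ust-20520-w4` (gen 4).  THEOREMS ONLY (0 `def`, 0 `sorry`).  Part (a) of the ym-inputs-p03 g2 ∕ ★w4-20520 g4 split (bus 2026-08-28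
10:44Z) of the knit's reality rows `h46tw`.(R-H) ∕ `hH₁R` (knit v2.9ˢ ✓`Prop7StubEXOfChartPiecesTwSR`): the ASSEMBLY through p01's layer-0 letters (✓`…SectET3HilbertLettersT3`,
✓`…GaugeProjectorT3`, ✓`…CurvedPropagatorsT3`, ✓`…DeltaPiT3`) over p03's generic reality lemmas (`B11Eq103H1ComplexReality`: `greenK_map_comm`, `adjoint_map_comm_of_anti∕_of_iso`,
`projR_map_comm_of_anti∕_of_iso`, `laplaceAK_map_comm`, `G1K∕KinvK∕H1K_map_comm`).  The DATA-level rows — `σ` commutes with `D_{U₀}` (`DL2`), with `Q(U₀)` (`QL2`; = (Q-a)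
✓`Prop7QTwSReality` on the `𝔰𝔲(2)` sector + (Q-b) on the scalar sector) and with `Δ^η_{U₀}` (`DeltaEta`) — stay DISPLAYED (p03's part (b) ∕ the `Δx`-slot row).  Nothing here closes
the stub; `--supports stmt-QuantumFields-19200 --as helper`, count-neutral.  YM₃ on T³ is a ladder rung (R3), not the Clay problem; nothing here claims the stub, the crux, d = 4 or the gap.

THE PRINT.  [Balaban1985BackgroundPropagators] p. 393: «Q_j(U) is a linear operator … with values in the Lie algebra 𝔤 … The operators … are real»; (3.21) `R`, (3.24)–(3.27) `Δ′_a`,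
`G′`, `Δ_a`, `G`, (3.119) `Δ_π = Pᵀ Δ P`, `P = 1 − DG′RD*`, (3.122)–(3.126) `G`, `H = GQ*(QGQ*)⁻¹`.  [Balaban1985Variational] (51) p. 286: «for A′ with values in 𝔤 the configuration
D(A′) has values in 𝔤 also»; (45)–(46) p. 285 the letter `H`.  Reality of an inverse ∕ adjoint ∕ orthogonal projection ∕ composite is inherited from reality of its data — with
«real» meaning: commuting with an additive involution `σ` that is anti-unitary (the conjugation `X ↦ −X*` of `𝔤ᶜ`, fibrewise) or unitary (the reflection of a sector, e.g. the traceless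
matrices) — both cases are carried below by ONE disjunctive hypothesis `hkind`.

WHAT IS PROVED (sorry-free, no definition).  For a triple of additive involutions `σE` (vector fields `BondL2K`), `σS` (gauge parameters `SiteL2K`), `σF` (block fields `WL2 … cB`),
jointly anti-unitary or jointly unitary (`hkind`), commuting with real scalars, and commuting with the data `DL2 U₀`, `QL2 U₀`:
* §1 derived data: `DstarL2_comm` (via ✓`adjoint_DL2`), `covLapSite_comm`, `QDS_comm`, `adjoint_QDS_comm`, `Qk_comm`, `adjoint_Qk_comm`;
* §2 the gauge-parameter storey: `laplacePrimeA_comm`, ★`GprimeT_comm`, ★`RS_comm` (`projR`), ★`gaugeCorr_comm`, ★★`DeltaPi_comm` (given `DeltaEta U₀` commutes);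
* §3 the L0d storey at an ARBITRARY slot `Δx` commuting with `σE`: `laplaceA_comm`, ★`GT_comm`, ★`KinvT_comm`, ★★`HT_comm`, and the function-level reading ★★`Hf_comm`
  (for the TRANSPORTED involutions `toL2⁻¹ ∘ σE ∘ toL2`, `toL2B⁻¹ ∘ σF ∘ toL2B`);
* §4 at the slot of record `Δx := DeltaPiSlot`: ★★★`Hpi_comm`, ★★★`H46_comm` — print's `H(U₀)` of `h46tw` commutes with the transported involutions, given ONLY the three data rows
  `hD`, `hQ`, `hΔη` and the `σ`-triple's own properties.
The pointwise reading («`H46 U₀` maps skew-Hermitian traceless block data to skew-Hermitian traceless fields», the knit's clause) is the instantiation at the concrete conjugation ∕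
traceless-reflection triple of part (b) (ym-inputs-p03 g2 `…HilbertLettersT3Reality`), not typed here.

References: T. Bałaban, CMP 99 (1985) 389–434 [Balaban1985BackgroundPropagators] (p.393, (3.21)–(3.27) pp.394–395, (3.119)–(3.126) pp.419–420); CMP 102 (1985) 277–309
[Balaban1985Variational] ((45)–(46) p.285, (51) p.286).
-/

set_option autoImplicit false

noncomputable section

open scoped InnerProductSpace ComplexConjugate Matrix.Norms.L2Operator BigOperators

namespace Summit.QuantumFields.YangMills.Theorems.Prop7SectET3PropagatorsReality

open Literature.MathematicalPhysics.QuantumFieldTheory.Balaban1983to89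
open Literature.MathematicalPhysics.QuantumFieldTheory.Balaban1983to89.T3ContinuumYM3Torus
open T3SectALandauChart (eta)
open B9SectCLatticeCarrier (Bond)
open B9Eq311L2Pairing (WL2)
open B11Eq103H1Complex (SiteL2K BondL2K greenK projR laplaceALatticeK G1LatticeK KinvLatticeK H1LatticeK)
open B11Eq103H1ComplexReality (greenK_map_comm adjoint_map_comm_of_anti adjoint_map_comm_of_iso projR_map_comm_of_anti projR_map_comm_of_iso
  laplaceAK_map_comm G1K_map_comm KinvK_map_comm H1K_map_comm)
open Summit.QuantumFields.YangMills.Theorems.Prop7SectET3Transport (periodsT3)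
open Summit.QuantumFields.YangMills.Theorems.Prop7SectET3HilbertLetters (W₂ toL2 toL2B QL2 DL2 DstarL2 covLapSite covLapSite_eq adjoint_DL2)
open Summit.QuantumFields.YangMills.Theorems.Prop7SectET3GaugeProjector (QDS RS RS_eq_projR)
open Summit.QuantumFields.YangMills.Theorems.Prop7SectET3CurvedPropagators (Qk laplaceA PosOnto GT KinvT HT Hf GT_of_pos GT_of_not KinvT_of_pos KinvT_of_not HT_of_pos HT_of_not Hf_apply)
open Summit.QuantumFields.YangMills.Theorems.Prop7SectET3WilsonHessian (DeltaEta)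
open Summit.QuantumFields.YangMills.Theorems.Prop7SectET3DeltaPi (laplacePrimeA PosPrime GprimeT gaugeCorr DeltaPi DeltaPiSlot Hpi H46 GprimeT_of_pos GprimeT_of_not)

/-! ## §0 Two frame-free helpers: the adjoint and the projector `R` under a jointly (anti-)unitary pair -/

section FrameFree

variable {E F : Type*} [NormedAddCommGroup E] [InnerProductSpace ℂ E] [NormedAddCommGroup F] [InnerProductSpace ℂ F]
  [FiniteDimensional ℂ E] [FiniteDimensional ℂ F]

/-- An additive map fixes `0`. [folklore] -/
theorem map_zero_of_map_add {X : Type*} [AddCommGroup X] (σ : X → X) (hadd : ∀ x y, σ (x + y) = σ x + σ y) : σ 0 = 0 := by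
  have h := hadd 0 0
  rw [add_zero] at h
  exact left_eq_add.mp h

/-- An additive map respects `−`. [folklore] -/
theorem map_sub_of_map_add {X : Type*} [AddCommGroup X] (σ : X → X) (hadd : ∀ x y, σ (x + y) = σ x + σ y) (x y : X) :
    σ (x - y) = σ x - σ y := by
  have h := hadd (x - y) y
  rw [sub_add_cancel] at h
  rw [h, add_sub_cancel_right]

/-- **ADJOINTS OF REAL OPERATORS ARE REAL — both kinds at once**: `T∘σ_E = σ_F∘T ⟹ T†∘σ_F = σ_E∘T†` for a pair of involutions that is jointly anti-unitary OR jointly unitary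
(p03's `adjoint_map_comm_of_anti` ∕ `_of_iso`). [cite: Balaban1985BackgroundPropagators, p.391, p.393; Balaban1985Variational, (51) p.286] -/
theorem adjoint_comm_of_kind (T : E →ₗ[ℂ] F) (σE : E → E) (σF : F → F)
    (hkind : ((∀ x y : E, ⟪σE x, σE y⟫_ℂ = ⟪y, x⟫_ℂ) ∧ (∀ x y : F, ⟪σF x, σF y⟫_ℂ = ⟪y, x⟫_ℂ)) ∨
      ((∀ x y : E, ⟪σE x, σE y⟫_ℂ = ⟪x, y⟫_ℂ) ∧ (∀ x y : F, ⟪σF x, σF y⟫_ℂ = ⟪x, y⟫_ℂ)))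
    (hE2 : ∀ x, σE (σE x) = x) (hF2 : ∀ y, σF (σF y) = y) (hT : ∀ x, T (σE x) = σF (T x)) (y : F) :
    LinearMap.adjoint T (σF y) = σE (LinearMap.adjoint T y) := by
  rcases hkind with ⟨hE, hF⟩ | ⟨hE, hF⟩
  · exact adjoint_map_comm_of_anti T σE σF hE hE2 hF hF2 hT y
  · exact adjoint_map_comm_of_iso T σE σF hE hE2 hF hF2 hT y

/-- **THE PROJECTOR `R` OF (3.21) IS REAL WITH ITS DATA — both kinds at once** (p03's `projR_map_comm_of_anti` ∕ `_of_iso`).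
[cite: Balaban1985BackgroundPropagators, (3.20)–(3.23) p.394, p.393] -/
theorem projR_comm_of_kind {F' : Type*} [AddCommGroup F'] [Module ℂ F'] (Δs : E →ₗ[ℂ] E) (Q' : E →ₗ[ℂ] F') (σ : E → E)
    (hkind : (∀ x y : E, ⟪σ x, σ y⟫_ℂ = ⟪y, x⟫_ℂ) ∨ (∀ x y : E, ⟪σ x, σ y⟫_ℂ = ⟪x, y⟫_ℂ))
    (hadd : ∀ x y, σ (x + y) = σ x + σ y) (hσ2 : ∀ x, σ (σ x) = x)
    (hΔ : ∀ x, Δs (σ x) = σ (Δs x)) (hQ : ∀ l, Q' l = 0 → Q' (σ l) = 0) (x : E) :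
    projR Δs Q' (σ x) = σ (projR Δs Q' x) := by
  rcases hkind with hσ | hσ
  · exact projR_map_comm_of_anti Δs Q' σ hadd hσ hσ2 hΔ hQ x
  · exact projR_map_comm_of_iso Δs Q' σ hadd hσ hσ2 hΔ hQ x

end FrameFree

/-! ## The member's letters -/

variable (F : T3Family) (n K : ℕ) (h : n ≤ K) (c₀ cB a : ℝ) [Fact (0 < c₀)] [Fact (0 < cB)]
variable (U₀ : GaugeField (F.P K) 0 (Matrix.specialUnitaryGroup (Fin 2) ℂ))
variable (σE : BondL2K ℂ 3 (periodsT3 F K) c₀ W₂ → BondL2K ℂ 3 (periodsT3 F K) c₀ W₂)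
variable (σS : SiteL2K ℂ 3 (periodsT3 F K) c₀ W₂ → SiteL2K ℂ 3 (periodsT3 F K) c₀ W₂)
variable (σF : WL2 ℂ (fun _ : PBond (F.P n) 0 => cB) W₂ → WL2 ℂ (fun _ : PBond (F.P n) 0 => cB) W₂)

/-! ## §1 Derived data: `D*`, `Δ^η = D*D`, `Q′ = QD`, `Q′†`, `Q_k = η·Q`, `Q_k†` -/

/-- **`D*_{U₀}` IS REAL WHEN `D_{U₀}` IS** (`D* = D†`, ✓`adjoint_DL2`). [cite: Balaban1985BackgroundPropagators, (3.8) p.392, p.393] -/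
theorem DstarL2_comm
    (hkind : ((∀ x y : BondL2K ℂ 3 (periodsT3 F K) c₀ W₂, ⟪σE x, σE y⟫_ℂ = ⟪y, x⟫_ℂ) ∧ (∀ x y : SiteL2K ℂ 3 (periodsT3 F K) c₀ W₂, ⟪σS x, σS y⟫_ℂ = ⟪y, x⟫_ℂ)) ∨
      ((∀ x y : BondL2K ℂ 3 (periodsT3 F K) c₀ W₂, ⟪σE x, σE y⟫_ℂ = ⟪x, y⟫_ℂ) ∧ (∀ x y : SiteL2K ℂ 3 (periodsT3 F K) c₀ W₂, ⟪σS x, σS y⟫_ℂ = ⟪x, y⟫_ℂ)))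
    (hE2 : ∀ x, σE (σE x) = x) (hS2 : ∀ s, σS (σS s) = s)
    (hD : ∀ s, DL2 F n K c₀ U₀ (σS s) = σE (DL2 F n K c₀ U₀ s)) (x : BondL2K ℂ 3 (periodsT3 F K) c₀ W₂) :
    DstarL2 F n K c₀ U₀ (σE x) = σS (DstarL2 F n K c₀ U₀ x) := by
  rw [← adjoint_DL2]
  have hkind' : ((∀ x y : SiteL2K ℂ 3 (periodsT3 F K) c₀ W₂, ⟪σS x, σS y⟫_ℂ = ⟪y, x⟫_ℂ) ∧ (∀ x y : BondL2K ℂ 3 (periodsT3 F K) c₀ W₂, ⟪σE x, σE y⟫_ℂ = ⟪y, x⟫_ℂ)) ∨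
      ((∀ x y : SiteL2K ℂ 3 (periodsT3 F K) c₀ W₂, ⟪σS x, σS y⟫_ℂ = ⟪x, y⟫_ℂ) ∧ (∀ x y : BondL2K ℂ 3 (periodsT3 F K) c₀ W₂, ⟪σE x, σE y⟫_ℂ = ⟪x, y⟫_ℂ)) :=
    hkind.elim (fun h => Or.inl ⟨h.2, h.1⟩) (fun h => Or.inr ⟨h.2, h.1⟩)
  exact adjoint_comm_of_kind (DL2 F n K c₀ U₀) σS σE hkind' hS2 hE2 hD x

/-- **`Δ^η_{U₀} = D*D` IS REAL WHEN `D`, `D*` ARE.** [cite: Balaban1985BackgroundPropagators, (3.23) p.394] -/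
theorem covLapSite_comm (hD : ∀ s, DL2 F n K c₀ U₀ (σS s) = σE (DL2 F n K c₀ U₀ s))
    (hDs : ∀ x, DstarL2 F n K c₀ U₀ (σE x) = σS (DstarL2 F n K c₀ U₀ x)) (s : SiteL2K ℂ 3 (periodsT3 F K) c₀ W₂) :
    covLapSite F n K c₀ U₀ (σS s) = σS (covLapSite F n K c₀ U₀ s) := by
  rw [covLapSite, LinearMap.comp_apply, LinearMap.comp_apply, hD, hDs]

omit [Fact (0 < cB)] in
/-- **`Q′ = Q(U₀)∘D_{U₀}` IS REAL WHEN `Q`, `D` ARE.** [cite: Balaban1985BackgroundPropagators, (3.114)–(3.115) p.418] -/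
theorem QDS_comm (hD : ∀ s, DL2 F n K c₀ U₀ (σS s) = σE (DL2 F n K c₀ U₀ s))
    (hQ : ∀ x, QL2 F n K h c₀ cB U₀ (σE x) = σF (QL2 F n K h c₀ cB U₀ x)) (s : SiteL2K ℂ 3 (periodsT3 F K) c₀ W₂) :
    QDS F n K h c₀ cB U₀ (σS s) = σF (QDS F n K h c₀ cB U₀ s) := by
  rw [QDS, LinearMap.comp_apply, LinearMap.comp_apply, hD, hQ]

omit [Fact (0 < c₀)] [Fact (0 < cB)] in
/-- **`Q_k = η·Q` IS REAL WHEN `Q` IS** (`η` real). [cite: Balaban1985Variational, (44)–(45) p.285] -/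
theorem Qk_comm (hFsmul : ∀ (r : ℝ) (y : WL2 ℂ (fun _ : PBond (F.P n) 0 => cB) W₂), σF (((r : ℝ) : ℂ) • y) = ((r : ℝ) : ℂ) • σF y)
    (hQ : ∀ x, QL2 F n K h c₀ cB U₀ (σE x) = σF (QL2 F n K h c₀ cB U₀ x)) (x : BondL2K ℂ 3 (periodsT3 F K) c₀ W₂) :
    Qk F n K h c₀ cB U₀ (σE x) = σF (Qk F n K h c₀ cB U₀ x) := by
  rw [Qk, LinearMap.smul_apply, LinearMap.smul_apply, hQ, hFsmul]

/-! ## §2 The gauge-parameter storey: `Δ′_a`, `G′`, `R`, the gauge correction, `Δ_π` -/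

section GaugeStorey

variable (hkind : ((∀ x y : BondL2K ℂ 3 (periodsT3 F K) c₀ W₂, ⟪σE x, σE y⟫_ℂ = ⟪y, x⟫_ℂ) ∧ (∀ x y : SiteL2K ℂ 3 (periodsT3 F K) c₀ W₂, ⟪σS x, σS y⟫_ℂ = ⟪y, x⟫_ℂ) ∧
      (∀ x y : WL2 ℂ (fun _ : PBond (F.P n) 0 => cB) W₂, ⟪σF x, σF y⟫_ℂ = ⟪y, x⟫_ℂ)) ∨
    ((∀ x y : BondL2K ℂ 3 (periodsT3 F K) c₀ W₂, ⟪σE x, σE y⟫_ℂ = ⟪x, y⟫_ℂ) ∧ (∀ x y : SiteL2K ℂ 3 (periodsT3 F K) c₀ W₂, ⟪σS x, σS y⟫_ℂ = ⟪x, y⟫_ℂ) ∧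
      (∀ x y : WL2 ℂ (fun _ : PBond (F.P n) 0 => cB) W₂, ⟪σF x, σF y⟫_ℂ = ⟪x, y⟫_ℂ)))
  (hEadd : ∀ x y, σE (x + y) = σE x + σE y) (hSadd : ∀ x y, σS (x + y) = σS x + σS y) (hFadd : ∀ x y, σF (x + y) = σF x + σF y)
  (hE2 : ∀ x, σE (σE x) = x) (hS2 : ∀ s, σS (σS s) = s) (hF2 : ∀ y, σF (σF y) = y)
  (hEsmul : ∀ (r : ℝ) (x : BondL2K ℂ 3 (periodsT3 F K) c₀ W₂), σE (((r : ℝ) : ℂ) • x) = ((r : ℝ) : ℂ) • σE x)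
  (hSsmul : ∀ (r : ℝ) (s : SiteL2K ℂ 3 (periodsT3 F K) c₀ W₂), σS (((r : ℝ) : ℂ) • s) = ((r : ℝ) : ℂ) • σS s)
  (hFsmul : ∀ (r : ℝ) (y : WL2 ℂ (fun _ : PBond (F.P n) 0 => cB) W₂), σF (((r : ℝ) : ℂ) • y) = ((r : ℝ) : ℂ) • σF y)
  (hD : ∀ s, DL2 F n K c₀ U₀ (σS s) = σE (DL2 F n K c₀ U₀ s))
  (hQ : ∀ x, QL2 F n K h c₀ cB U₀ (σE x) = σF (QL2 F n K h c₀ cB U₀ x))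

include hkind hE2 hS2 hD in
/-- `D*` commutes (kind-packaged form of `DstarL2_comm`). [cite: Balaban1985BackgroundPropagators, (3.8) p.392] -/
theorem DstarL2_comm' (x : BondL2K ℂ 3 (periodsT3 F K) c₀ W₂) : DstarL2 F n K c₀ U₀ (σE x) = σS (DstarL2 F n K c₀ U₀ x) :=
  DstarL2_comm F n K c₀ U₀ σE σS (hkind.elim (fun hk => Or.inl ⟨hk.1, hk.2.1⟩) (fun hk => Or.inr ⟨hk.1, hk.2.1⟩)) hE2 hS2 hD x

include hkind hS2 hF2 hD hQ in
/-- **`Q′†` IS REAL WHEN `Q′` IS.** [cite: Balaban1985BackgroundPropagators, (3.24) p.394, p.393] -/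
theorem adjoint_QDS_comm (y : WL2 ℂ (fun _ : PBond (F.P n) 0 => cB) W₂) :
    LinearMap.adjoint (QDS F n K h c₀ cB U₀) (σF y) = σS (LinearMap.adjoint (QDS F n K h c₀ cB U₀) y) :=
  adjoint_comm_of_kind (QDS F n K h c₀ cB U₀) σS σF (hkind.elim (fun hk => Or.inl ⟨hk.2.1, hk.2.2⟩) (fun hk => Or.inr ⟨hk.2.1, hk.2.2⟩)) hS2 hF2
    (QDS_comm F n K h c₀ cB U₀ σE σS σF hD hQ) y

include hkind hE2 hF2 hFsmul hQ in
/-- **`Q_k†` IS REAL WHEN `Q` IS.** [cite: Balaban1985BackgroundPropagators, p.391, (3.126) p.420] -/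
theorem adjoint_Qk_comm (y : WL2 ℂ (fun _ : PBond (F.P n) 0 => cB) W₂) :
    LinearMap.adjoint (Qk F n K h c₀ cB U₀) (σF y) = σE (LinearMap.adjoint (Qk F n K h c₀ cB U₀) y) :=
  adjoint_comm_of_kind (Qk F n K h c₀ cB U₀) σE σF (hkind.elim (fun hk => Or.inl ⟨hk.1, hk.2.2⟩) (fun hk => Or.inr ⟨hk.1, hk.2.2⟩)) hE2 hF2
    (Qk_comm F n K h c₀ cB U₀ σE σF hFsmul hQ) y

include hkind hSadd hE2 hS2 hF2 hSsmul hD hQ in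
/-- **`Δ′_a = Δ^η + a·Q′*Q′` (3.24) IS REAL WITH ITS DATA.** [cite: Balaban1985BackgroundPropagators, (3.24) p.394] -/
theorem laplacePrimeA_comm (s : SiteL2K ℂ 3 (periodsT3 F K) c₀ W₂) :
    laplacePrimeA F n K h c₀ cB a U₀ (σS s) = σS (laplacePrimeA F n K h c₀ cB a U₀ s) := by
  have hDs := DstarL2_comm' F n K c₀ cB U₀ σE σS σF hkind hE2 hS2 hD
  rw [laplacePrimeA, LinearMap.add_apply, LinearMap.add_apply, LinearMap.smul_apply, LinearMap.smul_apply, LinearMap.comp_apply, LinearMap.comp_apply,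
    covLapSite_comm F n K c₀ U₀ σE σS hD hDs, QDS_comm F n K h c₀ cB U₀ σE σS σF hD hQ,
    adjoint_QDS_comm F n K h c₀ cB U₀ σE σS σF hkind hS2 hF2 hD hQ, hSadd, hSsmul]

include hkind hSadd hE2 hS2 hF2 hSsmul hD hQ in
/-- ★ **`G′ = (Δ′_a)⁻¹` (3.25) IS REAL WITH ITS DATA** (on the class `PosPrime` by `greenK_map_comm`; off it the total letter is `0`). [cite: Balaban1985BackgroundPropagators, (3.25) p.394, p.393] -/
theorem GprimeT_comm (s : SiteL2K ℂ 3 (periodsT3 F K) c₀ W₂) :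
    GprimeT F n K h c₀ cB a U₀ (σS s) = σS (GprimeT F n K h c₀ cB a U₀ s) := by
  by_cases hp : PosPrime F n K h c₀ cB a U₀
  · rw [GprimeT_of_pos hp]
    exact greenK_map_comm hp.pos σS (laplacePrimeA_comm F n K h c₀ cB a U₀ σE σS σF hkind hSadd hE2 hS2 hF2 hSsmul hD hQ) s
  · rw [GprimeT_of_not hp, LinearMap.zero_apply, LinearMap.zero_apply, map_zero_of_map_add σS hSadd]

include hkind hSadd hFadd hE2 hS2 hD hQ in
/-- ★ **`R(U₀)` (3.21) IS REAL WITH ITS DATA** (`R_S = projR Δ^η Q′`, ✓`RS_eq_projR`; `N(Q′)` is `σ`-stable since `Q′` commutes and `σ_F 0 = 0`).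
[cite: Balaban1985BackgroundPropagators, (3.20)–(3.23) p.394] -/
theorem RS_comm (s : SiteL2K ℂ 3 (periodsT3 F K) c₀ W₂) : RS F n K h c₀ cB U₀ (σS s) = σS (RS F n K h c₀ cB U₀ s) := by
  have hDs := DstarL2_comm' F n K c₀ cB U₀ σE σS σF hkind hE2 hS2 hD
  rw [RS_eq_projR]
  refine projR_comm_of_kind (covLapSite F n K c₀ U₀) (QDS F n K h c₀ cB U₀) σS
    (hkind.elim (fun hk => Or.inl hk.2.1) (fun hk => Or.inr hk.2.1)) hSadd hS2 (covLapSite_comm F n K c₀ U₀ σE σS hD hDs) (fun l hl => ?_) s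
  rw [QDS_comm F n K h c₀ cB U₀ σE σS σF hD hQ, hl, map_zero_of_map_add σF hFadd]

include hkind hEadd hSadd hFadd hE2 hS2 hF2 hSsmul hD hQ in
/-- ★ **THE GAUGE CORRECTION `1 − DG′RD*` (3.119) IS REAL WITH ITS DATA.** [cite: Balaban1985BackgroundPropagators, (3.119) p.419] -/
theorem gaugeCorr_comm (x : BondL2K ℂ 3 (periodsT3 F K) c₀ W₂) : gaugeCorr F n K h c₀ cB a U₀ (σE x) = σE (gaugeCorr F n K h c₀ cB a U₀ x) := by
  have hDs := DstarL2_comm' F n K c₀ cB U₀ σE σS σF hkind hE2 hS2 hD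
  rw [gaugeCorr, LinearMap.sub_apply, LinearMap.sub_apply, LinearMap.id_apply, LinearMap.id_apply, LinearMap.comp_apply, LinearMap.comp_apply, LinearMap.comp_apply,
    LinearMap.comp_apply, LinearMap.comp_apply, LinearMap.comp_apply, hDs, RS_comm F n K h c₀ cB U₀ σE σS σF hkind hSadd hFadd hE2 hS2 hD hQ,
    GprimeT_comm F n K h c₀ cB a U₀ σE σS σF hkind hSadd hE2 hS2 hF2 hSsmul hD hQ, hD, map_sub_of_map_add σE hEadd]

include hkind hEadd hSadd hFadd hE2 hS2 hF2 hSsmul hD hQ in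
/-- ★★ **`Δ_π = Pᵀ Δ^η P` (3.119) IS REAL WHEN `Δ^η_{U₀}` IS** (and the data `D`, `Q` are): `P = 1 − DG′RD*` commutes by `gaugeCorr_comm`, `Pᵀ = P†` by `adjoint_comm_of_kind`.
[cite: Balaban1985BackgroundPropagators, (3.118)–(3.120) p.419] -/
theorem DeltaPi_comm
    (hΔη : ∀ x, DeltaEta F n K c₀ U₀ (σE x) = σE (DeltaEta F n K c₀ U₀ x)) (x : BondL2K ℂ 3 (periodsT3 F K) c₀ W₂) :
    DeltaPi F n K h c₀ cB a U₀ (σE x) = σE (DeltaPi F n K h c₀ cB a U₀ x) := by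
  have hP := gaugeCorr_comm F n K h c₀ cB a U₀ σE σS σF hkind hEadd hSadd hFadd hE2 hS2 hF2 hSsmul hD hQ
  have hPa : ∀ y, LinearMap.adjoint (gaugeCorr F n K h c₀ cB a U₀) (σE y) = σE (LinearMap.adjoint (gaugeCorr F n K h c₀ cB a U₀) y) :=
    adjoint_comm_of_kind (gaugeCorr F n K h c₀ cB a U₀) σE σE (hkind.elim (fun hk => Or.inl ⟨hk.1, hk.1⟩) (fun hk => Or.inr ⟨hk.1, hk.1⟩)) hE2 hE2 hP
  rw [DeltaPi, LinearMap.comp_apply, LinearMap.comp_apply, LinearMap.comp_apply, LinearMap.comp_apply, hP, ContinuousLinearMap.coe_coe, hΔη, hPa]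

end GaugeStorey

/-! ## §3 The L0d storey at an arbitrary slot `Δx`: `Δ_a`, `G`, `(QGQ*)⁻¹`, `H`, and the function-level `Hf` -/

section CurvedStorey

variable (Δx : GaugeField (F.P K) 0 (Matrix.specialUnitaryGroup (Fin 2) ℂ) → (BondL2K ℂ 3 (periodsT3 F K) c₀ W₂ →ₗ[ℂ] BondL2K ℂ 3 (periodsT3 F K) c₀ W₂))

variable (hkind : ((∀ x y : BondL2K ℂ 3 (periodsT3 F K) c₀ W₂, ⟪σE x, σE y⟫_ℂ = ⟪y, x⟫_ℂ) ∧ (∀ x y : SiteL2K ℂ 3 (periodsT3 F K) c₀ W₂, ⟪σS x, σS y⟫_ℂ = ⟪y, x⟫_ℂ) ∧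
      (∀ x y : WL2 ℂ (fun _ : PBond (F.P n) 0 => cB) W₂, ⟪σF x, σF y⟫_ℂ = ⟪y, x⟫_ℂ)) ∨
    ((∀ x y : BondL2K ℂ 3 (periodsT3 F K) c₀ W₂, ⟪σE x, σE y⟫_ℂ = ⟪x, y⟫_ℂ) ∧ (∀ x y : SiteL2K ℂ 3 (periodsT3 F K) c₀ W₂, ⟪σS x, σS y⟫_ℂ = ⟪x, y⟫_ℂ) ∧
      (∀ x y : WL2 ℂ (fun _ : PBond (F.P n) 0 => cB) W₂, ⟪σF x, σF y⟫_ℂ = ⟪x, y⟫_ℂ)))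
  (hEadd : ∀ x y, σE (x + y) = σE x + σE y) (hSadd : ∀ x y, σS (x + y) = σS x + σS y) (hFadd : ∀ x y, σF (x + y) = σF x + σF y)
  (hE2 : ∀ x, σE (σE x) = x) (hS2 : ∀ s, σS (σS s) = s) (hF2 : ∀ y, σF (σF y) = y)
  (hEsmul : ∀ (r : ℝ) (x : BondL2K ℂ 3 (periodsT3 F K) c₀ W₂), σE (((r : ℝ) : ℂ) • x) = ((r : ℝ) : ℂ) • σE x)
  (hSsmul : ∀ (r : ℝ) (s : SiteL2K ℂ 3 (periodsT3 F K) c₀ W₂), σS (((r : ℝ) : ℂ) • s) = ((r : ℝ) : ℂ) • σS s)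
  (hFsmul : ∀ (r : ℝ) (y : WL2 ℂ (fun _ : PBond (F.P n) 0 => cB) W₂), σF (((r : ℝ) : ℂ) • y) = ((r : ℝ) : ℂ) • σF y)
  (hD : ∀ s, DL2 F n K c₀ U₀ (σS s) = σE (DL2 F n K c₀ U₀ s))
  (hQ : ∀ x, QL2 F n K h c₀ cB U₀ (σE x) = σF (QL2 F n K h c₀ cB U₀ x))
  (hΔx : ∀ x, Δx U₀ (σE x) = σE (Δx U₀ x))

include hkind hEadd hSadd hFadd hE2 hS2 hF2 hFsmul hD hQ hΔx in
/-- **`Δ_a = Δx + DR_SD* + Q_k*aQ_k` (3.26)∕(3.122) IS REAL WITH ITS DATA** (`laplaceA = laplaceALatticeK … = laplaceAK …` at `D := DL2`, `D* := DstarL2`, `Q* := Q_k†`, by `rfl`).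
[cite: Balaban1985BackgroundPropagators, (3.26) p.395, (3.122) p.420] -/
theorem laplaceA_comm (x : BondL2K ℂ 3 (periodsT3 F K) c₀ W₂) :
    laplaceA F n K h c₀ cB a Δx U₀ (σE x) = σE (laplaceA F n K h c₀ cB a Δx U₀ x) := by
  have hDs := DstarL2_comm' F n K c₀ cB U₀ σE σS σF hkind hE2 hS2 hD
  have key := laplaceAK_map_comm (Δ := Δx U₀) (D := DL2 F n K c₀ U₀) (R := RS F n K h c₀ cB U₀) (Dstar := DstarL2 F n K c₀ U₀) (Q := Qk F n K h c₀ cB U₀)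
    (Qadj := LinearMap.adjoint (Qk F n K h c₀ cB U₀)) (a := ((a : ℝ) : ℂ)) (σE := σE) (σS := σS) (σF := σF) hEadd hΔx hD
    (RS_comm F n K h c₀ cB U₀ σE σS σF hkind hSadd hFadd hE2 hS2 hD hQ) hDs (Qk_comm F n K h c₀ cB U₀ σE σF hFsmul hQ)
    (adjoint_Qk_comm F n K h c₀ cB U₀ σE σS σF hkind hE2 hF2 hFsmul hQ) (hFsmul a) x
  exact key

include hkind hEadd hSadd hFadd hE2 hS2 hF2 hFsmul hD hQ hΔx in
/-- ★ **`G = Δ_a⁻¹` IS REAL WITH ITS DATA** (on the class `PosOnto` it is lit-balaban's `G1LatticeK = G1K`; off it `0`). [cite: Balaban1985BackgroundPropagators, (3.27) p.395, (3.122) p.420, p.393] -/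
theorem GT_comm (x : BondL2K ℂ 3 (periodsT3 F K) c₀ W₂) : GT F n K h c₀ cB a Δx U₀ (σE x) = σE (GT F n K h c₀ cB a Δx U₀ x) := by
  by_cases hp : PosOnto F n K h c₀ cB a Δx U₀
  · rw [GT_of_pos hp]
    exact greenK_map_comm hp.pos σE (laplaceA_comm F n K h c₀ cB a U₀ σE σS σF Δx hkind hEadd hSadd hFadd hE2 hS2 hF2 hFsmul hD hQ hΔx) x
  · rw [GT_of_not hp, LinearMap.zero_apply, LinearMap.zero_apply, map_zero_of_map_add σE hEadd]

include hkind hEadd hSadd hFadd hE2 hS2 hF2 hFsmul hD hQ hΔx in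
/-- ★ **`(QGQ*)⁻¹` IS REAL WITH ITS DATA.** [cite: Balaban1985BackgroundPropagators, (3.122)–(3.126) p.420; Balaban1985Variational, (45) p.285] -/
theorem KinvT_comm (y : WL2 ℂ (fun _ : PBond (F.P n) 0 => cB) W₂) : KinvT F n K h c₀ cB a Δx U₀ (σF y) = σF (KinvT F n K h c₀ cB a Δx U₀ y) := by
  by_cases hp : PosOnto F n K h c₀ cB a Δx U₀
  · rw [KinvT_of_pos hp]
    exact KinvK_map_comm hp.pos _ _ hEadd hΔx hD (RS_comm F n K h c₀ cB U₀ σE σS σF hkind hSadd hFadd hE2 hS2 hD hQ)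
      (DstarL2_comm' F n K c₀ cB U₀ σE σS σF hkind hE2 hS2 hD) (Qk_comm F n K h c₀ cB U₀ σE σF hFsmul hQ)
      (adjoint_Qk_comm F n K h c₀ cB U₀ σE σS σF hkind hE2 hF2 hFsmul hQ) (hFsmul a) y
  · rw [KinvT_of_not hp, LinearMap.zero_apply, LinearMap.zero_apply, map_zero_of_map_add σF hFadd]

include hkind hEadd hSadd hFadd hE2 hS2 hF2 hFsmul hD hQ hΔx in
/-- ★★ **`H = GQ*(QGQ*)⁻¹` (3.126) IS REAL WITH ITS DATA** — print's «for 𝔤-valued `B`, `HB` is 𝔤-valued» at the member's total letter `HT` (on the class: lit-balaban's `H1LatticeK = H1K`,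
p03's `H1K_map_comm`; off it `0`). [cite: Balaban1985BackgroundPropagators, (3.126) p.420, p.393; Balaban1985Variational, (45) p.285, (51) p.286] -/
theorem HT_comm (y : WL2 ℂ (fun _ : PBond (F.P n) 0 => cB) W₂) : HT F n K h c₀ cB a Δx U₀ (σF y) = σE (HT F n K h c₀ cB a Δx U₀ y) := by
  by_cases hp : PosOnto F n K h c₀ cB a Δx U₀
  · rw [HT_of_pos hp]
    exact H1K_map_comm hp.pos _ _ hEadd hΔx hD (RS_comm F n K h c₀ cB U₀ σE σS σF hkind hSadd hFadd hE2 hS2 hD hQ)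
      (DstarL2_comm' F n K c₀ cB U₀ σE σS σF hkind hE2 hS2 hD) (Qk_comm F n K h c₀ cB U₀ σE σF hFsmul hQ)
      (adjoint_Qk_comm F n K h c₀ cB U₀ σE σS σF hkind hE2 hF2 hFsmul hQ) (hFsmul a) y
  · rw [HT_of_not hp, LinearMap.zero_apply, LinearMap.zero_apply, map_zero_of_map_add σE hEadd]

include hkind hEadd hSadd hFadd hE2 hS2 hF2 hEsmul hFsmul hD hQ hΔx in
/-- ★★ **THE LETTER `Hf = η·(toL2⁻¹ ∘ H ∘ toL2B)` IS REAL FOR THE TRANSPORTED INVOLUTIONS** `σb := toL2B⁻¹ ∘ σ_F ∘ toL2B` on block functions and `σf := toL2⁻¹ ∘ σ_E ∘ toL2` on vector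
functions: `Hf (σb Y) = σf (Hf Y)` (`η` real). [cite: Balaban1985Variational, (45)–(46) p.285, (51) p.286] -/
theorem Hf_comm (Y : PBond (F.P n) 0 → Matrix (Fin 2) (Fin 2) ℂ) :
    Hf F n K h c₀ cB a Δx U₀ ((toL2B F n cB).symm (σF (toL2B F n cB Y))) = (toL2 F K c₀).symm (σE (toL2 F K c₀ (Hf F n K h c₀ cB a Δx U₀ Y))) := by
  rw [Hf_apply, Hf_apply, LinearEquiv.apply_symm_apply, HT_comm F n K h c₀ cB a U₀ σE σS σF Δx hkind hEadd hSadd hFadd hE2 hS2 hF2 hFsmul hD hQ hΔx,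
    map_smul, LinearEquiv.apply_symm_apply, hEsmul, map_smul]

end CurvedStorey

/-! ## §4 At the slot of record `Δx := Δ_π`: print's `H(U₀)` of `h46tw` -/

section Record

variable (hkind : ((∀ x y : BondL2K ℂ 3 (periodsT3 F K) c₀ W₂, ⟪σE x, σE y⟫_ℂ = ⟪y, x⟫_ℂ) ∧ (∀ x y : SiteL2K ℂ 3 (periodsT3 F K) c₀ W₂, ⟪σS x, σS y⟫_ℂ = ⟪y, x⟫_ℂ) ∧
      (∀ x y : WL2 ℂ (fun _ : PBond (F.P n) 0 => cB) W₂, ⟪σF x, σF y⟫_ℂ = ⟪y, x⟫_ℂ)) ∨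
    ((∀ x y : BondL2K ℂ 3 (periodsT3 F K) c₀ W₂, ⟪σE x, σE y⟫_ℂ = ⟪x, y⟫_ℂ) ∧ (∀ x y : SiteL2K ℂ 3 (periodsT3 F K) c₀ W₂, ⟪σS x, σS y⟫_ℂ = ⟪x, y⟫_ℂ) ∧
      (∀ x y : WL2 ℂ (fun _ : PBond (F.P n) 0 => cB) W₂, ⟪σF x, σF y⟫_ℂ = ⟪x, y⟫_ℂ)))
  (hEadd : ∀ x y, σE (x + y) = σE x + σE y) (hSadd : ∀ x y, σS (x + y) = σS x + σS y) (hFadd : ∀ x y, σF (x + y) = σF x + σF y)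
  (hE2 : ∀ x, σE (σE x) = x) (hS2 : ∀ s, σS (σS s) = s) (hF2 : ∀ y, σF (σF y) = y)
  (hEsmul : ∀ (r : ℝ) (x : BondL2K ℂ 3 (periodsT3 F K) c₀ W₂), σE (((r : ℝ) : ℂ) • x) = ((r : ℝ) : ℂ) • σE x)
  (hSsmul : ∀ (r : ℝ) (s : SiteL2K ℂ 3 (periodsT3 F K) c₀ W₂), σS (((r : ℝ) : ℂ) • s) = ((r : ℝ) : ℂ) • σS s)
  (hFsmul : ∀ (r : ℝ) (y : WL2 ℂ (fun _ : PBond (F.P n) 0 => cB) W₂), σF (((r : ℝ) : ℂ) • y) = ((r : ℝ) : ℂ) • σF y)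
  (hD : ∀ s, DL2 F n K c₀ U₀ (σS s) = σE (DL2 F n K c₀ U₀ s))
  (hQ : ∀ x, QL2 F n K h c₀ cB U₀ (σE x) = σF (QL2 F n K h c₀ cB U₀ x))
  (hΔη : ∀ x, DeltaEta F n K c₀ U₀ (σE x) = σE (DeltaEta F n K c₀ U₀ x))

include hkind hEadd hSadd hFadd hE2 hS2 hF2 hSsmul hFsmul hD hQ hΔη in
/-- ★★★ **PRINT'S `H(U₀) = GQ*(QGQ*)⁻¹` OF (3.126) AT THE SLOT OF RECORD (`Hpi`, Hilbert level) IS REAL**, given only that `D_{U₀}`, `Q(U₀)`, `Δ^η_{U₀}` commute with the involution triple.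
[cite: Balaban1985BackgroundPropagators, (3.119)–(3.126) pp.419–420, p.393; Balaban1985Variational, (45) p.285, (51) p.286] -/
theorem Hpi_comm (y : WL2 ℂ (fun _ : PBond (F.P n) 0 => cB) W₂) : Hpi F n K h c₀ cB a U₀ (σF y) = σE (Hpi F n K h c₀ cB a U₀ y) :=
  HT_comm F n K h c₀ cB a U₀ σE σS σF (DeltaPiSlot F n K h c₀ cB a) hkind hEadd hSadd hFadd hE2 hS2 hF2 hFsmul hD hQ
    (DeltaPi_comm F n K h c₀ cB a U₀ σE σS σF hkind hEadd hSadd hFadd hE2 hS2 hF2 hSsmul hD hQ hΔη) y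

include hkind hEadd hSadd hFadd hE2 hS2 hF2 hEsmul hSsmul hFsmul hD hQ hΔη in
/-- ★★★ **THE `h46tw` LETTER `H46 U₀` IS REAL FOR THE TRANSPORTED INVOLUTIONS**: `H46 U₀ (σb Y) = σf (H46 U₀ Y)` with `σb := toL2B⁻¹ ∘ σ_F ∘ toL2B`, `σf := toL2⁻¹ ∘ σ_E ∘ toL2`, given only the
three data rows (`D_{U₀}`, `Q(U₀)`, `Δ^η_{U₀}` commute) and the involution triple's own properties — the (R-H) clause of the EX knit's `h46tw` modulo part (b)'s identification of the
transported involutions with the pointwise conjugation ∕ traceless reflection. [cite: Balaban1985Variational, (45)–(46) p.285, (51) p.286; Balaban1985BackgroundPropagators, (3.126) p.420, p.393] -/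
theorem H46_comm (Y : PBond (F.P n) 0 → Matrix (Fin 2) (Fin 2) ℂ) :
    H46 F n K h c₀ cB a U₀ ((toL2B F n cB).symm (σF (toL2B F n cB Y))) = (toL2 F K c₀).symm (σE (toL2 F K c₀ (H46 F n K h c₀ cB a U₀ Y))) :=
  Hf_comm F n K h c₀ cB a U₀ σE σS σF (DeltaPiSlot F n K h c₀ cB a) hkind hEadd hSadd hFadd hE2 hS2 hF2 hEsmul hFsmul hD hQ
    (DeltaPi_comm F n K h c₀ cB a U₀ σE σS σF hkind hEadd hSadd hFadd hE2 hS2 hF2 hSsmul hD hQ hΔη) Y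

end Record

end Summit.QuantumFields.YangMills.Theorems.Prop7SectET3PropagatorsReality

end
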